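import Literature.NumberTheory.GaloisRepresentations.TateDualBiduality
import Literature.NumberTheory.GaloisRepresentations.LocalKummerTorsion
import HarnessLib

/-!
# Mixed-level biduality `M ⥲ Hom(Hom(M, μₙ), μ_d)` for a finite module killed by `n` and `d`,
# and the double transpose of an adjoint pair (levels `(n, d)`, `(n', d')`)

Topic `NumberTheory/GaloisRepresentations`; namespace
`Literature.NumberTheory.GaloisRepresentations(.DiscreteGaloisModule)`.  Definitions WITH BODIES (`muCast`,
`bidual₂`, `bidualEquiv₂`, `bidualInv₂`, `doubleTranspose₂`) and theorems; no named fact, no `sorry`, no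
instance, no notation.  Companion of `TateDualBiduality.lean` (the case `d = n`).

WHY TWO LEVELS (lane «PT-Ш-S-TC» of cell `bsd-eis`, brick D5c).  The named fact
`poitouTate_shaRestricted_tateDual_natural(_at)` pairs `Ш²_S(K, M)` with `Ш¹_S(K, M^D(n))` for ANY level
`n ≥ 1` killing `M`, under the admissibility "`v ∣ #M ⇒ v ∈ S`" — NOT "`v ∣ n ⇒ v ∈ S`".  Kummer theory on
the `S`-units (the comparison `Extʳ(⟨A⟩, ⟨Ē_S⟩) ≅ Hʳ(G_S, A^D(d))`, bsd-eis -w7 g12) therefore runs at a level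
`d` with `v ∣ d ⇒ v ∈ S` (e.g. `d = #M`), and at `A = M^D(n)` it lands in `Hʳ(G_S, Hom(Hom(M, μₙ), μ_d))`;
the canonical MIXED-LEVEL biduality `ι₂ : M → Hom(Hom(M, μₙ), μ_d)`, `m ↦ (ψ ↦ ψ(m))` — well defined because
`ψ(m)^d = ψ(d m) = 1`, so `ψ(m) ∈ μₙ ∩ μ_d` (`muCast`) — brings it back to `Hʳ(G_S, M)`.

* §0 `muCast` (an `n`-th root of unity killed by `d`, read in `μ_d`), `muVal_muCast`.
* §1 `bidual₂ ρ n d hd : M →ⁱL Hom(Hom(M, μₙ), μ_d)` (`Γ_K`-equivariant), `muVal_bidual₂_apply`,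
  `bidual₂_bijective` (`CharZero K`; `n • M = 0`, `d • M = 0`: injective by `tateDualEval_injective`,
  then `#` counts), `bidualEquiv₂`, `bidualInv₂` (`κ₂`) with the two inverse laws.
* §2 `doubleTranspose₂ F := ι₂' ∘ F ∘ κ₂ : Hom(Hom(M, μₙ), μ_d) →ⁱL Hom(Hom(M', μ_{n'}), μ_{d'})`,
  `doubleTranspose₂_bidual₂`, `bidualInv₂_doubleTranspose₂` (`κ₂' ∘ F^{DD} = F ∘ κ₂`) and, for a pair
  `(F, G)` ADJOINT in `K̄ˣ` (`(G φ')(m) = φ'(F m)`), `muVal_doubleTranspose₂_apply :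
  (F^{DD} ψ)(φ') = ψ(G φ')` in `K̄ˣ` — the `hGφ` input of the comparison's naturality.

Milne, *ADT* I §0 Prop. 0.19 (`M^{DD} = M`) is the case `d = n`; the mixed case is the same statement for the
pairing `M × Hom(M, μₙ) → μ_d ⊆ μₙ`.  Nothing about Poitou–Tate or BSD is proved here.
AI formalisation, weaker than expert review; established only by the kernel check.

## References
* J. S. Milne, *Arithmetic Duality Theorems*, 2nd ed. (2006), Ch. I §0 Prop. 0.19, §2, Thm. 4.10 (a)
  (p. 57: "`S` contains all primes dividing the order of `M`"). [MilneADT2006]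
-/

noncomputable section

open Function Field
open scoped ContRepresentation

universe u

namespace Literature.NumberTheory.GaloisRepresentations

namespace DiscreteGaloisModule

/-! ## §0 Roots of unity of level `n` killed by `d` -/

section MuCast

variable (K : Type u) [Field K] {n d : ℕ}

/-- **An `n`-th root of unity killed by `d`, read as a `d`-th root of unity** (same element of `K̄ˣ`).
[cite: MilneADT2006, Ch. I §0] -/
def muCast (ζ : MuCarrier K n) (h : d • ζ = 0) : MuCarrier K d :=
  muOfUnit K d (muVal K n ζ) (by rw [← muVal_nsmul, h, muVal_zero])

/-- `muCast` does not change the underlying unit. [cite: MilneADT2006, Ch. I §0] -/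
@[simp] theorem muVal_muCast (ζ : MuCarrier K n) (h : d • ζ = 0) : muVal K d (muCast K ζ h) = muVal K n ζ := rfl

end MuCast

variable {K : Type u} [Field K] {M : Type u} [AddCommGroup M] [TopologicalSpace M]
  [DiscreteTopology M] [Finite M] (ρ : DiscreteGaloisModule K M) (n d : ℕ)

/-! ## §1 The mixed-level biduality and its inverse -/

omit [TopologicalSpace M] [DiscreteTopology M] [Finite M] in
/-- Values of `ψ ∈ Hom(M, μₙ)` are killed by `d` when `M` is: `d • ψ(m) = ψ(d m) = 0`. [cite: MilneADT2006, Ch. I §0] -/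
theorem nsmul_tateDual_apply_eq_zero (hd : ∀ m : M, d • m = 0) (ψ : TateDual K M n) (m : M) :
    d • ψ m = 0 := by
  have h : ψ (d • m) = d • ψ m := map_nsmul ψ d m
  rw [hd, map_zero] at h
  exact h.symm

omit [TopologicalSpace M] [DiscreteTopology M] [Finite M] in
/-- `Hom(M, μₙ)` is killed by `d` when `M` is. [cite: MilneADT2006, Ch. I §0] -/
theorem nsmul_tateDual_eq_zero_of_nsmul (hd : ∀ m : M, d • m = 0) (ψ : TateDual K M n) : d • ψ = 0 := by
  refine TateDual.ext fun m => ?_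
  change d • ψ m = 0
  exact nsmul_tateDual_apply_eq_zero n d hd ψ m

variable (K M) in
omit [TopologicalSpace M] [DiscreteTopology M] [Finite M] in
/-- The additive map `m ↦ (ψ ↦ ψ(m) ∈ μ_d)`, `M →+ Hom(Hom(M, μₙ), μ_d)`. [cite: MilneADT2006, Ch. I §0 Prop. 0.19] -/
def bidual₂AddHom (hd : ∀ m : M, d • m = 0) : M →+ TateDual K (TateDual K M n) d where
  toFun m :=
    { toFun := fun ψ => muCast K (ψ m) (nsmul_tateDual_apply_eq_zero n d hd ψ m)
      map_zero' := muVal_injective K d rfl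
      map_add' := fun _ _ => muVal_injective K d rfl }
  map_zero' := TateDual.ext fun ψ => muVal_injective K d (by
    change muVal K n (ψ 0) = muVal K d 0
    rw [map_zero]; rfl)
  map_add' m m' := TateDual.ext fun ψ => muVal_injective K d (by
    change muVal K n (ψ (m + m')) = muVal K n (ψ m) * muVal K n (ψ m')
    rw [map_add]; rfl)

omit [TopologicalSpace M] [DiscreteTopology M] [Finite M] in
/-- Formula: `(ι₂ m)(ψ) = ψ(m)` in `K̄ˣ`. [cite: MilneADT2006, Ch. I §0 Prop. 0.19] -/
@[simp] theorem muVal_bidual₂AddHom_apply (hd : ∀ m : M, d • m = 0) (m : M) (ψ : TateDual K M n) :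
    muVal K d (bidual₂AddHom K M n d hd m ψ) = muVal K n (ψ m) := rfl

variable [Finite (TateDual K M n)]

/-- **Mixed-level biduality `ι₂ : M → Hom(Hom(M, μₙ), μ_d)`, `m ↦ (ψ ↦ ψ m)`, as a continuous
`Γ_K`-intertwining map** (equivariance: `(σ·ι₂ m)(ψ) = σ((ι₂ m)(σ⁻¹ψ)) = σ σ⁻¹ ψ(σ m) = (ι₂ (σ m))(ψ)`).
[cite: MilneADT2006, Ch. I §0 Prop. 0.19] -/
def bidual₂ (hd : ∀ m : M, d • m = 0) :
    ρ.toContRepresentation →ⁱL ((ρ.tateDual n).tateDual d).toContRepresentation where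
  toContinuousLinearMap := ⟨(bidual₂AddHom K M n d hd).toIntLinearMap, continuous_of_discreteTopology⟩
  isIntertwining' σ := by
    refine ContinuousLinearMap.ext fun m => ?_
    change bidual₂AddHom K M n d hd (ρ σ m) = (ρ.tateDual n).tateDual d σ (bidual₂AddHom K M n d hd m)
    refine TateDual.ext fun ψ => muVal_injective K d ?_
    rw [muVal_bidual₂AddHom_apply, tateDual_apply_apply_apply, muVal_apply, muVal_bidual₂AddHom_apply,
      tateDual_apply_apply_apply, inv_inv, muVal_apply, smul_smul, mul_inv_cancel, one_smul]

/-- Formula: `(bidual₂ ρ n d hd m)(ψ) = ψ(m)` in `K̄ˣ`. [cite: MilneADT2006, Ch. I §0 Prop. 0.19] -/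
@[simp] theorem muVal_bidual₂_apply (hd : ∀ m : M, d • m = 0) (m : M) (ψ : TateDual K M n) :
    muVal K d (bidual₂ ρ n d hd m ψ) = muVal K n (ψ m) := rfl

/-- **`ι₂` is bijective** for `M` finite killed by `n ≥ 1` and `d ≥ 1` over a field of characteristic `0`:
injective since the `ψ(m)` determine `m` (`tateDualEval_injective`), and
`# Hom(Hom(M, μₙ), μ_d) = # Hom(M, μₙ) = # M`. [cite: MilneADT2006, Ch. I §0 Prop. 0.19] -/
theorem bidual₂_bijective [CharZero K] [NeZero n] [NeZero d] (hd : ∀ m : M, d • m = 0)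
    (hn : ∀ m : M, n • m = 0) : Bijective (bidual₂ ρ n d hd) := by
  have hinj : Injective (bidual₂ ρ n d hd) := by
    intro m m' h
    have h' : ∀ ψ : TateDual K M n, ψ m = ψ m' := fun ψ => muVal_injective K n (by
      have hψ := congrArg (fun Φ : TateDual K (TateDual K M n) d => muVal K d (Φ ψ)) h
      simp only [muVal_bidual₂_apply] at hψ
      exact hψ)
    exact tateDualEval_injective (K := K) (M := M) n hn (TateDual.ext fun ψ => h' ψ)
  have hc1 : Nat.card (TateDual K M n) = Nat.card M := HomCarrier.natCard_eq (muEquivZMod K n) hn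
  have hc2 : Nat.card (TateDual K (TateDual K M n) d) = Nat.card (TateDual K M n) :=
    HomCarrier.natCard_eq (muEquivZMod K d) (nsmul_tateDual_eq_zero_of_nsmul n d hd)
  haveI hfin : Finite (TateDual K (TateDual K M n) d) := TateDual.finite K (TateDual K M n) d
  haveI : Finite (TateDual K M n →+ MuCarrier K d) := hfin
  refine hinj.bijective_of_nat_card_le ?_
  rw [hc2, hc1]

/-- The mixed-level biduality as an additive equivalence. [cite: MilneADT2006, Ch. I §0 Prop. 0.19] -/
def bidualEquiv₂ [CharZero K] [NeZero n] [NeZero d] (hd : ∀ m : M, d • m = 0) (hn : ∀ m : M, n • m = 0) :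
    M ≃+ TateDual K (TateDual K M n) d :=
  AddEquiv.ofBijective (bidual₂AddHom K M n d hd) (bidual₂_bijective ρ n d hd hn)

/-- `bidualEquiv₂` is `bidual₂` on elements. [cite: MilneADT2006, Ch. I §0 Prop. 0.19] -/
@[simp] theorem bidualEquiv₂_apply [CharZero K] [NeZero n] [NeZero d] (hd : ∀ m : M, d • m = 0)
    (hn : ∀ m : M, n • m = 0) (m : M) : bidualEquiv₂ ρ n d hd hn m = bidual₂ ρ n d hd m := rfl

/-- **The inverse `κ₂ : Hom(Hom(M, μₙ), μ_d) → M` as a continuous `Γ_K`-intertwining map.**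
[cite: MilneADT2006, Ch. I §0 Prop. 0.19] -/
def bidualInv₂ [CharZero K] [NeZero n] [NeZero d] (hd : ∀ m : M, d • m = 0) (hn : ∀ m : M, n • m = 0) :
    ((ρ.tateDual n).tateDual d).toContRepresentation →ⁱL ρ.toContRepresentation where
  toContinuousLinearMap := ⟨(bidualEquiv₂ ρ n d hd hn).symm.toAddMonoidHom.toIntLinearMap,
    continuous_of_discreteTopology⟩
  isIntertwining' σ := by
    refine ContinuousLinearMap.ext fun ψ => ?_
    change (bidualEquiv₂ ρ n d hd hn).symm (((ρ.tateDual n).tateDual d) σ ψ) =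
      ρ σ ((bidualEquiv₂ ρ n d hd hn).symm ψ)
    apply (bidualEquiv₂ ρ n d hd hn).injective
    rw [AddEquiv.apply_symm_apply]
    have h := DFunLike.congr_fun ((bidual₂ ρ n d hd).isIntertwining' σ) ((bidualEquiv₂ ρ n d hd hn).symm ψ)
    change bidual₂ ρ n d hd (ρ σ ((bidualEquiv₂ ρ n d hd hn).symm ψ)) =
      (ρ.tateDual n).tateDual d σ (bidual₂ ρ n d hd ((bidualEquiv₂ ρ n d hd hn).symm ψ)) at h
    change _ = bidual₂ ρ n d hd (ρ σ ((bidualEquiv₂ ρ n d hd hn).symm ψ))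
    rw [h]
    change ((ρ.tateDual n).tateDual d) σ ψ =
      ((ρ.tateDual n).tateDual d) σ (bidualEquiv₂ ρ n d hd hn ((bidualEquiv₂ ρ n d hd hn).symm ψ))
    rw [AddEquiv.apply_symm_apply]

/-- `κ₂ (ι₂ m) = m`. [cite: MilneADT2006, Ch. I §0 Prop. 0.19] -/
@[simp] theorem bidualInv₂_bidual₂ [CharZero K] [NeZero n] [NeZero d] (hd : ∀ m : M, d • m = 0)
    (hn : ∀ m : M, n • m = 0) (m : M) : bidualInv₂ ρ n d hd hn (bidual₂ ρ n d hd m) = m :=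
  (bidualEquiv₂ ρ n d hd hn).symm_apply_apply m

/-- `ι₂ (κ₂ ψ) = ψ`. [cite: MilneADT2006, Ch. I §0 Prop. 0.19] -/
@[simp] theorem bidual₂_bidualInv₂ [CharZero K] [NeZero n] [NeZero d] (hd : ∀ m : M, d • m = 0)
    (hn : ∀ m : M, n • m = 0) (ψ : TateDual K (TateDual K M n) d) :
    bidual₂ ρ n d hd (bidualInv₂ ρ n d hd hn ψ) = ψ :=
  (bidualEquiv₂ ρ n d hd hn).apply_symm_apply ψ

/-! ## §2 The double transpose of an adjoint pair, levels `(n, d)` and `(n', d')` -/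

variable {M' : Type u} [AddCommGroup M'] [TopologicalSpace M'] [DiscreteTopology M'] [Finite M']
  (ρ' : DiscreteGaloisModule K M') (n' d' : ℕ) [Finite (TateDual K M' n')]

/-- **The double transpose `F^{DD} := ι₂' ∘ F ∘ κ₂ : Hom(Hom(M, μₙ), μ_d) → Hom(Hom(M', μ_{n'}), μ_{d'})`**
of a continuous `Γ_K`-map `F : M → M'`. [cite: MilneADT2006, Ch. I §0 Prop. 0.19] -/
def doubleTranspose₂ [CharZero K] [NeZero n] [NeZero d] (hd : ∀ m : M, d • m = 0) (hn : ∀ m : M, n • m = 0)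
    (hd' : ∀ m' : M', d' • m' = 0) (F : ρ.toContRepresentation →ⁱL ρ'.toContRepresentation) :
    ((ρ.tateDual n).tateDual d).toContRepresentation →ⁱL
      ((ρ'.tateDual n').tateDual d').toContRepresentation :=
  ((bidual₂ ρ' n' d' hd').comp F).comp (bidualInv₂ ρ n d hd hn)

/-- Unfolding `doubleTranspose₂`. [cite: MilneADT2006, Ch. I §0 Prop. 0.19] -/
theorem doubleTranspose₂_apply [CharZero K] [NeZero n] [NeZero d] (hd : ∀ m : M, d • m = 0)
    (hn : ∀ m : M, n • m = 0) (hd' : ∀ m' : M', d' • m' = 0)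
    (F : ρ.toContRepresentation →ⁱL ρ'.toContRepresentation) (ψ : TateDual K (TateDual K M n) d) :
    doubleTranspose₂ ρ n d ρ' n' d' hd hn hd' F ψ = bidual₂ ρ' n' d' hd' (F (bidualInv₂ ρ n d hd hn ψ)) :=
  rfl

/-- **`F^{DD} ∘ ι₂ = ι₂' ∘ F`**. [cite: MilneADT2006, Ch. I §0 Prop. 0.19] -/
theorem doubleTranspose₂_bidual₂ [CharZero K] [NeZero n] [NeZero d] (hd : ∀ m : M, d • m = 0)
    (hn : ∀ m : M, n • m = 0) (hd' : ∀ m' : M', d' • m' = 0)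
    (F : ρ.toContRepresentation →ⁱL ρ'.toContRepresentation) (m : M) :
    doubleTranspose₂ ρ n d ρ' n' d' hd hn hd' F (bidual₂ ρ n d hd m) = bidual₂ ρ' n' d' hd' (F m) := by
  rw [doubleTranspose₂_apply, bidualInv₂_bidual₂]

/-- **`κ₂' ∘ F^{DD} = F ∘ κ₂`**. [cite: MilneADT2006, Ch. I §0 Prop. 0.19] -/
theorem bidualInv₂_doubleTranspose₂ [CharZero K] [NeZero n] [NeZero d] [NeZero n'] [NeZero d']
    (hd : ∀ m : M, d • m = 0) (hn : ∀ m : M, n • m = 0) (hd' : ∀ m' : M', d' • m' = 0)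
    (hn' : ∀ m' : M', n' • m' = 0)
    (F : ρ.toContRepresentation →ⁱL ρ'.toContRepresentation) (ψ : TateDual K (TateDual K M n) d) :
    bidualInv₂ ρ' n' d' hd' hn' (doubleTranspose₂ ρ n d ρ' n' d' hd hn hd' F ψ) =
      F (bidualInv₂ ρ n d hd hn ψ) := by
  rw [doubleTranspose₂_apply, bidualInv₂_bidual₂]

/-- **The double transpose is adjoint to `G`**: if `(G φ')(m) = φ'(F m)` in `K̄ˣ` for all `φ'`, `m`, then
`(F^{DD} ψ)(φ') = ψ(G φ')` in `K̄ˣ` for all `ψ`, `φ'`. [cite: MilneADT2006, Ch. I §0 Prop. 0.19] -/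
theorem muVal_doubleTranspose₂_apply [CharZero K] [NeZero n] [NeZero d] (hd : ∀ m : M, d • m = 0)
    (hn : ∀ m : M, n • m = 0) (hd' : ∀ m' : M', d' • m' = 0)
    (F : ρ.toContRepresentation →ⁱL ρ'.toContRepresentation) (G : TateDual K M' n' → TateDual K M n)
    (hFG : ∀ (φ' : TateDual K M' n') (m : M),
      ((Additive.toMul (G φ' m) : rootsOfUnity n (AlgebraicClosure K)) : (AlgebraicClosure K)ˣ) =
        ((Additive.toMul (φ' (F m)) : rootsOfUnity n' (AlgebraicClosure K)) : (AlgebraicClosure K)ˣ))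
    (ψ : TateDual K (TateDual K M n) d) (φ' : TateDual K M' n') :
    muVal K d' (doubleTranspose₂ ρ n d ρ' n' d' hd hn hd' F ψ φ') = muVal K d (ψ (G φ')) := by
  have hψ : ψ = bidual₂ ρ n d hd (bidualInv₂ ρ n d hd hn ψ) := (bidual₂_bidualInv₂ ρ n d hd hn ψ).symm
  conv_rhs => rw [hψ]
  rw [doubleTranspose₂_apply, muVal_bidual₂_apply, muVal_bidual₂_apply]
  exact (hFG φ' (bidualInv₂ ρ n d hd hn ψ)).symm

end DiscreteGaloisModule

end Literature.NumberTheory.GaloisRepresentations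

end
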